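import Summits.BirchSwinnertonDyer.BirchSwinnertonDyer.Theorems.SylvesterTwoHeegnerIndexStrictSelmerBookkeeping
import Summits.BirchSwinnertonDyer.BirchSwinnertonDyer.Theorems.SylvesterTwoHeegnerIndexLocalTypes
import Summits.BirchSwinnertonDyer.Rank1Residual.X12.CubeSumSylvesterOddPart
import Literature.NumberTheory.EllipticCurves.RealPeriod
import Literature.NumberTheory.EllipticCurves.HeegnerPoints
import Mathlib.RingTheory.Norm.Basic
import HarnessLib

/-!
# Route `SylvesterTwoHeegnerIndex` (rung K7t): two more `2`-adic frame constants of 𝒞_HSY —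
# `E_p(K)[2] = 0` over EVERY quadratic field `K` (so `ord₂ #E_p(K)_tors = 0`), and ONE real component

Cell `b2b-bsdres`, unit `b2b-bsdres-x1b` (X12 prover owner / O12 class lead, gen 47). HONEST FRAMING
(verbatim in every file of the cell): the cell DELETES the combination-shaped residual classes of the
BSD formula in analytic rank `≤ 1` from PUBLISHED theorems only and TYPES the construction-shaped ones;
O12 is CONSTRUCTION-SHAPED and stays so; tool theorems only; NO named fact; nothing booked; no label moves.
Companion of `…LocalTypes` (p421557) / `…TamagawaTwoPart` (p422388) and of the seat bsd-cm-k7t-c3's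
`…StrictSelmerBookkeeping` (p417881: `E_p(ℚ₂)[2] = 0`). Two more factors of the `2`-adic frame quotient
`P2.cmHeegnerIndexQuotient W K P c k Wd u = 8 I² t_W² / (n k² t_K² c² w² q_d |u| c_W)`:
* §1 `rat_cube_ne_432_mul_sq` — `432p²` is not a rational cube (k7t-c3's `2`-adic valuation lemma
  `SylvesterTwoLower.padic_cube_ne_432_mul_sq`, pulled back along `ℚ ↪ ℚ₂`);
* §2 `cube_ne_432_mul_sq_of_finrank_eq_two` — nor a cube in ANY quadratic field `K`: if `x³ = 432p²`
  in `K` then `N_{K/ℚ}(x)³ = (432p²)²`, so `432p² = (432p²/N(x))³` would be a rational cube (NORM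
  argument, Mathlib `Algebra.norm`); hence `two_torsion_eq_zero_of_model_of_finrank_eq_two` —
  **`E_p(K)[2] = 0` for every model of `E_p` and every quadratic number field `K`** (a `2`-torsion point
  of `y² = x³ − 432p²` has `y = 0`; transport along `VariableChange.pointEquiv` over `K`), in particular
  for the imaginary quadratic Heegner fields of the cruxes (`IsImaginaryQuadratic K`), and
  `padicValNat_two_torsionOrder_baseChange_eq_zero` — **`ord₂ t_K = 0`** UNCONDITIONALLY (if the torsion
  subgroup of `E_p(K)` is finite it has no element of order `2`, so odd order by Cauchy; if infinite,
  `torsionOrder` is the junk `0` and `padicValNat 2 0 = 0`);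
* §2b over `ℚ` itself: `two_torsion_eq_zero_of_model_rat` (`E_p(ℚ)[2] = 0`, the global twin of k7t-c3's
  `ℚ₂` statement) and `padicValNat_two_torsionOrder_eq_zero` — **`ord₂ t_W = 0`** unconditionally;
* §3 `numRealComponents_eq_one_of_model` — **`n = 1`**: every model of `E_p` has `Δ < 0` (`Δ = u⁻¹²·(−3⁹p⁴)`).
Not here: `t_W = #E_p(ℚ)_tors = 1` exactly (odd torsion; Selmer 1951), `k`, the Heegner index, the twin's terms.

References: J. H. Silverman, *AEC* III.2.3 (negation), VIII.7 (torsion); J. E. Cremona, *Algorithms* §3.7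
(real components); HOME `b2b-bsdres-x1b/X12-ROUTE.md` §51.
-/

set_option autoImplicit false
set_option linter.dupNamespace false

noncomputable section

open scoped Classical NumberField

open WeierstrassCurve NumberField Literature.NumberTheory.EllipticCurves
  Literature.NumberTheory.EllipticCurves.HuShuYin2019
  Summit.BirchSwinnertonDyer.Rank1Residual.X12.Sylvester
  Summit.BirchSwinnertonDyer.BirchSwinnertonDyer.Theorems.SylvesterTwoLower
  Summit.BirchSwinnertonDyer.BirchSwinnertonDyer.Theorems.SylvesterTwoLocalTypes

namespace Summit.BirchSwinnertonDyer.BirchSwinnertonDyer.Theorems.SylvesterTwoFrame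

variable {p : ℕ}

/-! ## §1 `432p²` is not a rational cube -/

/-- **No `q ∈ ℚ` with `q³ = 432p²`** (`p` an odd prime): `3·v₂(q) = v₂(432p²) = 4` is impossible
(k7t-c3's `padic_cube_ne_432_mul_sq` along `ℚ ↪ ℚ₂`). [folklore] -/
theorem rat_cube_ne_432_mul_sq (hp : p.Prime) (hp2 : p ≠ 2) (q : ℚ) : q ^ 3 ≠ 432 * (p : ℚ) ^ 2 := by
  intro h
  apply padic_cube_ne_432_mul_sq hp hp2 (q : ℚ_[2])
  have := congrArg (fun r : ℚ ↦ (r : ℚ_[2])) h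
  push_cast at this
  exact this

/-- **A group with no element of order `2` has torsion subgroup of odd (or junk-zero) `Nat.card`:**
`padicValNat 2 (Nat.card (torsion A)) = 0` — if the torsion subgroup is finite, Cauchy's theorem; if it is
infinite, `Nat.card = 0` and `padicValNat 2 0 = 0`. Generic in the group (and in its instance path, so that
it applies verbatim to the tree's `torsionOrder`). [folklore] -/
theorem padicValNat_two_natCard_torsion_eq_zero {A : Type*} {instA : AddCommGroup A}
    (h : ∀ a : A, 2 • a = 0 → a = 0) : padicValNat 2 (Nat.card (AddCommGroup.torsion A)) = 0 := by
  haveI : Fact (Nat.Prime 2) := ⟨Nat.prime_two⟩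
  by_cases hfin : Finite (AddCommGroup.torsion A)
  · apply padicValNat.eq_zero_of_not_dvd
    intro h2
    haveI : Fintype (AddCommGroup.torsion A) := Fintype.ofFinite _
    rw [Nat.card_eq_fintype_card] at h2
    obtain ⟨g, hg⟩ := exists_prime_addOrderOf_dvd_card 2 h2
    have hg2 : 2 • (g : A) = 0 := by
      have := addOrderOf_nsmul_eq_zero g
      rw [hg] at this
      exact_mod_cast congrArg Subtype.val this
    have : g = 0 := Subtype.ext (h g hg2)
    rw [this, addOrderOf_zero] at hg
    norm_num at hg
  · haveI : Infinite (AddCommGroup.torsion A) := not_finite_iff_infinite.mp hfin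
    rw [Nat.card_eq_zero_of_infinite]
    simp

/-! ## §2 … nor a cube in a quadratic field; `E_p(K)[2] = 0` -/

section Quadratic

variable (K : Type*) [Field K] [NumberField K]

/-- **No `x ∈ K` with `x³ = 432p²` for a QUADRATIC number field `K`** (`p` an odd prime): taking norms,
`N_{K/ℚ}(x)³ = N(432p²) = (432p²)²`, so `(432p²/N(x))³ = 432p²` in `ℚ`, contradicting §1.
[folklore] -/
theorem cube_ne_432_mul_sq_of_finrank_eq_two (hK : Module.finrank ℚ K = 2) (hp : p.Prime) (hp2 : p ≠ 2)
    (x : K) : x ^ 3 ≠ algebraMap ℚ K (432 * (p : ℚ) ^ 2) := by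
  intro hx
  set m : ℚ := 432 * (p : ℚ) ^ 2 with hm
  have hm0 : m ≠ 0 := mul_ne_zero (by norm_num) (pow_ne_zero _ (Nat.cast_ne_zero.mpr hp.ne_zero))
  have hN : (Algebra.norm ℚ x) ^ 3 = m ^ 2 := by
    rw [← map_pow, hx, Algebra.norm_algebraMap, hK]
  set n : ℚ := Algebra.norm ℚ x with hn
  have hn0 : n ≠ 0 := by
    intro h0; rw [h0] at hN; exact hm0 (pow_eq_zero_iff (n := 2) (by norm_num) |>.mp (by simpa using hN.symm))
  apply rat_cube_ne_432_mul_sq hp hp2 (m / n)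
  rw [← hm, div_pow, hN]
  field_simp

/-- **`E_p(K)[2] = 0` on the cube-sum model over a quadratic field**: the base change to `K` of
`cubeSumCurve p : y² = x³ − 432p²` (`p` an odd prime, `[K : ℚ] = 2`) has no point of order `2` — such a
point has `y = −y`, so `y = 0` and `x³ = 432p²` in `K`. [cite: SilvermanAEC2009, III.2.3 (negation formula)] -/
theorem two_torsion_eq_zero_cubeSumCurve_of_finrank_eq_two (hK : Module.finrank ℚ K = 2)
    (hp : p.Prime) (hp2 : p ≠ 2)
    (Q : ((cubeSumCurve (p : ℚ)).baseChange K).toAffine.Point) (hQ : 2 • Q = 0) : Q = 0 := by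
  rcases Q with _ | ⟨x, y, h⟩
  · rfl
  · exfalso
    have hneg : (Affine.Point.some x y h : ((cubeSumCurve (p : ℚ)).baseChange K).toAffine.Point)
        = -Affine.Point.some x y h := by
      rw [← add_eq_zero_iff_eq_neg, ← two_nsmul]; exact hQ
    rw [Affine.Point.neg_some, Affine.Point.some.injEq] at hneg
    have hy : y = 0 := by
      have h2 : y = -y := by
        have := hneg.2
        simpa [Affine.negY, cubeSumCurve, WeierstrassCurve.baseChange] using this
      have h3 : (2 : K) * y = 0 := by linear_combination h2
      simpa using h3
    have heq := (Affine.equation_iff x y).mp h.1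
    simp [cubeSumCurve, WeierstrassCurve.baseChange, hy] at heq
    apply cube_ne_432_mul_sq_of_finrank_eq_two K hK hp hp2 x
    rw [map_mul, map_pow, map_natCast]
    norm_num
    linear_combination -heq

/-- **`E_p(K)[2] = 0` for EVERY model and every QUADRATIC number field `K`**: if `C • W = cubeSumCurve p`
over `ℚ` (`p` an odd prime) then `W(K)` has no point of order `2` (transport along
`VariableChange.pointEquiv` over `K`). In the K7t frames `K` is imaginary quadratic
(`IsImaginaryQuadratic K`), so this is the `2`-part of `t_K = #E_p(K)_tors`. [cite: SilvermanAEC2009, III.3.1(b)] -/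
theorem two_torsion_eq_zero_of_model_of_finrank_eq_two (hK : Module.finrank ℚ K = 2)
    (hp : p.Prime) (hp2 : p ≠ 2)
    (W : WeierstrassCurve ℚ) (hW : ∃ C : VariableChange ℚ, C • W = cubeSumCurve (p : ℚ))
    (Q : (W.baseChange K).toAffine.Point) (hQ : 2 • Q = 0) : Q = 0 := by
  obtain ⟨C, hC⟩ := hW
  have heq : (C.map (algebraMap ℚ K)) • (W.baseChange K) = (cubeSumCurve (p : ℚ)).baseChange K := by
    rw [WeierstrassCurve.baseChange, WeierstrassCurve.map_variableChange, hC]; rfl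
  have htarget : ∀ R : ((C.map (algebraMap ℚ K)) • (W.baseChange K)).toAffine.Point, 2 • R = 0 → R = 0 := by
    rw [heq]; exact two_torsion_eq_zero_cubeSumCurve_of_finrank_eq_two K hK hp hp2
  exact two_smul_eq_zero_imp_of_addEquiv
    (VariableChange.pointEquiv (W.baseChange K) (C.map (algebraMap ℚ K))).symm htarget Q hQ

/-- The same for the imaginary quadratic fields of the cruxes' Heegner frames. [cite: SilvermanAEC2009, III.3.1(b)] -/
theorem two_torsion_eq_zero_of_model_of_isImaginaryQuadratic (hK : IsImaginaryQuadratic K)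
    (hp : p.Prime) (hp2 : p ≠ 2)
    (W : WeierstrassCurve ℚ) (hW : ∃ C : VariableChange ℚ, C • W = cubeSumCurve (p : ℚ))
    (Q : (W.baseChange K).toAffine.Point) (hQ : 2 • Q = 0) : Q = 0 :=
  two_torsion_eq_zero_of_model_of_finrank_eq_two K hK.1 hp hp2 W hW Q hQ

/-- **`ord₂ t_K = 0`**: for every model `W` of `E_p` (`p` an odd prime) and every quadratic number field
`K`, `padicValNat 2 (W.baseChange K).torsionOrder = 0` — UNCONDITIONALLY: if the torsion subgroup of
`W(K)` is finite it has no element of order `2` (above), hence odd order (Cauchy); if it were infinite,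
`torsionOrder = Nat.card = 0` and `padicValNat 2 0 = 0`. [cite: SilvermanAEC2009, VIII.7 (torsion is finite)] -/
theorem padicValNat_two_torsionOrder_baseChange_eq_zero (hK : Module.finrank ℚ K = 2)
    (hp : p.Prime) (hp2 : p ≠ 2)
    (W : WeierstrassCurve ℚ) (hW : ∃ C : VariableChange ℚ, C • W = cubeSumCurve (p : ℚ)) :
    padicValNat 2 (W.baseChange K).torsionOrder = 0 := by
  unfold WeierstrassCurve.torsionOrder
  exact padicValNat_two_natCard_torsion_eq_zero
    (two_torsion_eq_zero_of_model_of_finrank_eq_two K hK hp hp2 W hW)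

end Quadratic

/-! ## §2b Over `ℚ` itself: `E_p(ℚ)[2] = 0`, `ord₂ t_W = 0` -/

/-- **`E_p(ℚ)[2] = 0` on the cube-sum model**: a rational `2`-torsion point of `y² = x³ − 432p²` has
`y = 0` and `x³ = 432p²`, impossible (§1). (Stated for an ARBITRARY `DecidableEq ℚ` instance behind the
group law, so that it applies to the classical one frozen inside the tree's `torsionOrder`.)
[cite: SilvermanAEC2009, III.2.3 (negation formula)] -/
theorem two_torsion_eq_zero_cubeSumCurve_rat {instDec : DecidableEq ℚ} (hp : p.Prime) (hp2 : p ≠ 2)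
    (Q : (cubeSumCurve (p : ℚ)).toAffine.Point) (hQ : 2 • Q = 0) : Q = 0 := by
  rcases Q with _ | ⟨x, y, h⟩
  · rfl
  · exfalso
    have hneg : (Affine.Point.some x y h : (cubeSumCurve (p : ℚ)).toAffine.Point)
        = -Affine.Point.some x y h := by
      rw [← add_eq_zero_iff_eq_neg, ← two_nsmul]; exact hQ
    rw [Affine.Point.neg_some, Affine.Point.some.injEq] at hneg
    have hy : y = 0 := by
      have h2 : y = -y := by
        have := hneg.2
        simpa [Affine.negY, cubeSumCurve] using this
      have h3 : (2 : ℚ) * y = 0 := by linear_combination h2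
      simpa using h3
    have heq := (Affine.equation_iff x y).mp h.1
    simp [cubeSumCurve, hy] at heq
    exact rat_cube_ne_432_mul_sq hp hp2 x (by linear_combination -heq)

/-- **`E_p(ℚ)[2] = 0` for EVERY model** (`C • W = cubeSumCurve p`, `p` an odd prime).
[cite: SilvermanAEC2009, III.3.1(b)] -/
theorem two_torsion_eq_zero_of_model_rat {instDec : DecidableEq ℚ} (hp : p.Prime) (hp2 : p ≠ 2)
    (W : WeierstrassCurve ℚ) (hW : ∃ C : VariableChange ℚ, C • W = cubeSumCurve (p : ℚ))
    (Q : W.toAffine.Point) (hQ : 2 • Q = 0) : Q = 0 := by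
  obtain ⟨C, hC⟩ := hW
  have htarget : ∀ R : (C • W).toAffine.Point, 2 • R = 0 → R = 0 := by
    rw [hC]; exact two_torsion_eq_zero_cubeSumCurve_rat hp hp2
  exact two_smul_eq_zero_imp_of_addEquiv (VariableChange.pointEquiv W C).symm htarget Q hQ

/-- **`ord₂ t_W = 0`**: `padicValNat 2 W.torsionOrder = 0` for every model `W` of `E_p` (`p` an odd prime),
UNCONDITIONALLY (finite torsion without elements of order `2` has odd order; infinite ⇒ junk `0`).
(In fact `E_p(ℚ)_tors = 0` — Selmer 1951 — which is not needed for the `2`-part.) [cite: SilvermanAEC2009, VIII.7] -/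
theorem padicValNat_two_torsionOrder_eq_zero (hp : p.Prime) (hp2 : p ≠ 2)
    (W : WeierstrassCurve ℚ) (hW : ∃ C : VariableChange ℚ, C • W = cubeSumCurve (p : ℚ)) :
    padicValNat 2 W.torsionOrder = 0 := by
  unfold WeierstrassCurve.torsionOrder
  exact padicValNat_two_natCard_torsion_eq_zero (two_torsion_eq_zero_of_model_rat hp hp2 W hW)

/-! ## §3 One real component -/

/-- **`n = 1`: every model of `E_p` has exactly one real component** (`Δ(B) = u⁻¹²·Δ([0,0,p,0,−7p²]) =
u⁻¹²·(−3⁹p⁴) < 0`; `numRealComponents_of_Δ_nonpos`). [folklore] -/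
theorem numRealComponents_eq_one_of_model
    (B : WeierstrassCurve ℚ) (hB : ∃ C : VariableChange ℚ, C • B = cubeSumCurve (p : ℚ)) :
    (B.baseChange ℝ).numRealComponents = 1 := by
  obtain ⟨C, hC⟩ := hB
  apply numRealComponents_of_Δ_nonpos
  have hBs : (C⁻¹ * sylvesterScale p) • sylvesterCurve p = B := by
    rw [mul_smul, sylvesterScale_smul, ← hC, inv_smul_smul]
  have hΔ : B.Δ ≤ 0 := by
    rw [← hBs, variableChange_Δ, sylvesterCurve_Δ]
    exact mul_nonpos_of_nonneg_of_nonpos (by positivity) (by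
      have hp4 : (0 : ℚ) ≤ 19683 * (p : ℚ) ^ 4 := by positivity
      linarith)
  have hΔR : (B.baseChange ℝ).Δ = (B.Δ : ℝ) := by
    rw [WeierstrassCurve.baseChange, WeierstrassCurve.map_Δ]; rfl
  rw [hΔR]
  exact_mod_cast hΔ

end Summit.BirchSwinnertonDyer.BirchSwinnertonDyer.Theorems.SylvesterTwoFrame

end
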